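import Mathlib
import HarnessLib
import Literature.Probability.LatticeModels.LatticeGraph
import Summits.HubbardSuperconductivity.HubbardSuperconductivity.Theorems.BalabanIRBirComplexStableXYRSplitGlue
import Summits.HubbardSuperconductivity.HubbardSuperconductivity.Theorems.BalabanIRBirComplexStableXYEvenPositivity
import Summits.HubbardSuperconductivity.HubbardSuperconductivity.Theorems.BalabanIRBirComplexStableXYReality

/-!
# BalabanIR crux 2R `BirComplexStableXYR` (stmt-HubbardSuperconductivity-14845): the sharpened split glue
# `ComplexPositivityR3 → ComplexSliceDeficit → BirComplexStableXYR`, stated STRUCTURALLY (Theses-free)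

Line `log-concave-core-bounded-phase`, line lead c2 (skeleton S4, crux workfile
`Cruxes/BirComplexStableXYR/Lines/log_concave_core_bounded_phase.lean`).  S4 shrinks lead c1's two honest children
(glue `…SplitGlue.birComplexStableXYR_of_positivity_of_deficit`, p118048) to exactly their open content:

* child 1 (`ComplexPositivityR3`, hypothesis `h1`): real-part positivity `0 < Re Z` for window range `r ≥ 3` ONLY,
  `K ≥ K₀(r,B,c₀)`, even `L₀ ≤ L ≤ M` — the `r = 2` case is the landed `birEven_partitionFunction_pos` (every `K`, `L`,
  even `M`, via the table ⇒ functional bridge `timeReflection_functional_of_table`) and `Im Z = 0` is the landed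
  (R)-reality `partitionFunction_conj_eq_self` (every `r`);
* child 2 (`ComplexSliceDeficit`, hypothesis `h2`): the SLICE-AVERAGED complex deficit bound
  `Re ∫ D e^{−A} ≤ C/(c₀K)·Re Z`, `D = L⁻⁴ Σ_{x,y}(1 − cos(θ_{x,0} − θ_{y,0}))`, for `r ≥ 2` — strictly weaker than the
  pointwise two-point bound of p118048 and exactly what the endgame consumes (`O = 1 − D` pointwise);
* conclusion: the crux `BalabanIR.BirComplexStableXYR` VERBATIM (body of Theses/BalabanIR.lean, rev 11), so that
  `example : BirComplexStableXYR := birComplexStableXYR_of_rePos3_of_sliceDeficit h1 h2` in a file importing the Theses.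

Proof: `sg_core_avg` (weight abstract: `Re ∫ O·wt = Re Z − Re ∫ D·wt ≥ (1 − κ) Re Z`, and with `Im Z = 0`, `κ ≤ 1/2`
this is `Re(∫ O·wt / Z) ≥ 1/2`, `Z ≠ 0`), positivity for every `r ≥ 2` assembled from `h1` (r ≥ 3) and the landed
`r = 2` theorem, thresholds `K₀ = max (max K₀¹ K₀²) (max (2C/c₀) 1)`, `L₀ = max L₀¹ L₀²`.  No statement of the route
is restated as a definition (the three bodies appear only as hypothesis / conclusion types). [folklore]
-/

noncomputable section

namespace Summit.HubbardSuperconductivity.HubbardSuperconductivity.Theorems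

open scoped BigOperators ComplexConjugate
open MeasureTheory Literature.Probability.LatticeModels Complex

section SplitGlueR3

/-- **Core of the sharpened glue (weight abstract).**  For a continuous weight `wt` of modulus `≤ 1` on the cube
with `Z := ∫ wt`, `0 < Re Z`, `Im Z = 0`, and the slice-averaged deficit bound
`Re ∫ (L⁻⁴ Σ_{x,y} (1 − cos(θ_{x,0} − θ_{y,0})))·wt ≤ κ·Re Z` with `κ ≤ 1/2`: `Z ≠ 0` and `Re(∫ O·wt / Z) ≥ 1/2`
for the slice-order observable `O = |Σ_x e^{iθ_{x,0}}|²/L⁴ = 1 − D`. [folklore] -/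
theorem sg_core_avg (L M : ℕ) [NeZero L] [NeZero M] (wt : ((TorusSite 2 L × ZMod M) → ℝ) → ℂ)
    (hwc : Continuous wt) (hwb : ∀ θ, ‖wt θ‖ ≤ 1) {κ : ℝ} (hκ : κ ≤ 1 / 2)
    (hZpos : 0 < (∫ θ in Set.pi Set.univ (fun _ => Set.Icc (0:ℝ) (2 * Real.pi)), wt θ).re)
    (hZim : (∫ θ in Set.pi Set.univ (fun _ => Set.Icc (0:ℝ) (2 * Real.pi)), wt θ).im = 0)
    (hdef : (∫ θ in Set.pi Set.univ (fun _ => Set.Icc (0:ℝ) (2 * Real.pi)),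
        (((∑ x : TorusSite 2 L, ∑ y : TorusSite 2 L, (1 - Real.cos (θ (x, 0) - θ (y, 0)))) / (L : ℝ) ^ 4 : ℝ) : ℂ)
          * wt θ).re ≤
        κ * (∫ θ in Set.pi Set.univ (fun _ => Set.Icc (0:ℝ) (2 * Real.pi)), wt θ).re) :
    (∫ θ in Set.pi Set.univ (fun _ => Set.Icc (0:ℝ) (2 * Real.pi)), wt θ) ≠ 0 ∧
    (1/2 : ℝ) ≤ ((∫ θ in Set.pi Set.univ (fun _ => Set.Icc (0:ℝ) (2 * Real.pi)),
        ((‖∑ x : TorusSite 2 L, cexp (I * (θ (x, 0) : ℂ))‖ ^ 2 / (L : ℝ) ^ 4 : ℝ) : ℂ) * wt θ) /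
      (∫ θ in Set.pi Set.univ (fun _ => Set.Icc (0:ℝ) (2 * Real.pi)), wt θ)).re := by
  set cube : Set ((TorusSite 2 L × ZMod M) → ℝ) := Set.pi Set.univ (fun _ => Set.Icc (0:ℝ) (2 * Real.pi))
    with hcube
  set Z : ℂ := ∫ θ in cube, wt θ with hZ
  set D : ((TorusSite 2 L × ZMod M) → ℝ) → ℝ := fun θ =>
    (∑ x : TorusSite 2 L, ∑ y : TorusSite 2 L, (1 - Real.cos (θ (x, 0) - θ (y, 0)))) / (L : ℝ) ^ 4 with hD
  have hcard : (Fintype.card (TorusSite 2 L) : ℝ) = (L : ℝ) ^ 2 := by simp [TorusSite, ZMod.card]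
  have hL : (0 : ℝ) < L := by exact_mod_cast Nat.pos_of_ne_zero (NeZero.ne L)
  -- integrability
  have hint1 : Integrable (fun θ => (1 : ℂ) * wt θ) (volume.restrict cube) :=
    sg_integrable_mul_weight wt hwc hwb (fun _ => (1 : ℂ)) continuous_const 1 (fun _ => by simp)
  have hint0 : Integrable wt (volume.restrict cube) := by simpa using hint1
  have hintD : Integrable (fun θ => ((D θ : ℝ) : ℂ) * wt θ) (volume.restrict cube) := by
    refine sg_integrable_mul_weight wt hwc hwb _ ?_ 2 (fun θ => ?_)
    · refine Complex.continuous_ofReal.comp ?_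
      refine Continuous.div_const ?_ _
      exact continuous_finsetSum _ fun x _ => continuous_finsetSum _ fun y _ =>
        continuous_const.sub (Real.continuous_cos.comp ((continuous_apply _).sub (continuous_apply _)))
    · have h0 : 0 ≤ D θ := div_nonneg (Finset.sum_nonneg fun x _ => Finset.sum_nonneg fun y _ =>
        sub_nonneg.2 (Real.cos_le_one _)) (by positivity)
      have h1 : D θ ≤ 2 := by
        have hL4 : (0 : ℝ) < (L : ℝ) ^ 4 := by positivity
        change (∑ x : TorusSite 2 L, ∑ y : TorusSite 2 L, (1 - Real.cos (θ (x, 0) - θ (y, 0)))) /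
          (L : ℝ) ^ 4 ≤ 2
        rw [div_le_iff₀ hL4]
        calc (∑ x : TorusSite 2 L, ∑ y : TorusSite 2 L, (1 - Real.cos (θ (x, 0) - θ (y, 0))))
            ≤ ∑ _x : TorusSite 2 L, ∑ _y : TorusSite 2 L, (2 : ℝ) :=
              Finset.sum_le_sum fun x _ => Finset.sum_le_sum fun y _ => by
                linarith [Real.neg_one_le_cos (θ (x, 0) - θ (y, 0))]
          _ = 2 * (L : ℝ) ^ 4 := by
              simp only [Finset.sum_const, Finset.card_univ, nsmul_eq_mul, hcard]
              ring
      rw [Complex.norm_real, Real.norm_eq_abs, abs_of_nonneg h0]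
      exact h1
  -- the numerator identity `∫ O·wt = Z − ∫ D·wt`
  have hpt : ∀ θ : (TorusSite 2 L × ZMod M) → ℝ,
      (((‖∑ x : TorusSite 2 L, cexp (I * (θ (x, 0) : ℂ))‖ ^ 2 / (L : ℝ) ^ 4 : ℝ)) : ℂ) * wt θ =
        wt θ - ((D θ : ℝ) : ℂ) * wt θ := by
    intro θ
    rw [sg_sliceObs_eq L (fun x => θ (x, 0))]
    simp only [hD]
    push_cast
    ring
  have hnum : ∫ θ in cube, (((‖∑ x : TorusSite 2 L, cexp (I * (θ (x, 0) : ℂ))‖ ^ 2 /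
        (L : ℝ) ^ 4 : ℝ)) : ℂ) * wt θ = Z - ∫ θ in cube, ((D θ : ℝ) : ℂ) * wt θ := by
    simp_rw [hpt]
    exact integral_sub hint0 hintD
  have hDre : (∫ θ in cube, ((D θ : ℝ) : ℂ) * wt θ).re ≤ κ * Z.re := hdef
  have hre_main : (1 - κ) * Z.re ≤
      (∫ θ in cube, (((‖∑ x : TorusSite 2 L, cexp (I * (θ (x, 0) : ℂ))‖ ^ 2 /
        (L : ℝ) ^ 4 : ℝ)) : ℂ) * wt θ).re := by
    rw [hnum, Complex.sub_re]
    linarith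
  -- conclude
  have hZne : Z ≠ 0 := fun h => by rw [h, Complex.zero_re] at hZpos; exact lt_irrefl _ hZpos
  refine ⟨hZne, ?_⟩
  have hZeq : Z = ((Z.re : ℝ) : ℂ) := Complex.ext (by simp) (by simp [hZim])
  rw [hZeq, Complex.div_ofReal_re, le_div_iff₀ hZpos]
  nlinarith [hZpos, hre_main, hκ]

/-- **The sharpened split glue** (registered sub-goal `stub_splitGlueR3` of skeleton S4; alias
`birComplexStableXYR_of_rePos3_of_sliceDeficit` below) `ComplexPositivityR3 → ComplexSliceDeficit → BirComplexStableXYR`, all three stated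
STRUCTURALLY (bodies verbatim; the conclusion is the body of `BalabanIR.BirComplexStableXYR`, rev 11).  `r = 2`
positivity is the landed `birEven_partitionFunction_pos`, `Im Z = 0` the landed (R)-reality
`partitionFunction_conj_eq_self`; thresholds `K₀ = max (max K₀¹ K₀²) (max (2C/c₀) 1)` (with `K₀¹ := 0` at `r = 2`),
`L₀ = max L₀¹ L₀²`. [folklore] -/
theorem stub_splitGlueR3 :
    (∀ (r : ℕ) (B c₀ : ℝ), 3 ≤ r → 0 < c₀ → ∃ K₀ : ℝ, ∃ L₀ : ℕ, ∀ K : ℝ, K₀ ≤ K → ∀ c : ((Fin r × Fin r × Fin r) → ℤ) →₀ ℂ, (∀ n ∈ c.support, ∑ w, n w = 0) → c.sum (fun _ a => a) = 0 → c.sum (fun n a => ‖a‖ * Real.exp (∑ w, |(n w : ℝ)|)) ≤ B → (∀ φ : (Fin r × Fin r × Fin r) → ℝ, c₀ * ∑ w, ∑ w', (1 - Real.cos (φ w - φ w')) ≤ (c.sum (fun n a => a * cexp (I * ((∑ w, (n w : ℝ) * φ w : ℝ) : ℂ)))).re) → (∀ n : (Fin r × Fin r × Fin r) → ℤ, c (fun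 w => n (w.1, w.2.1, Fin.rev w.2.2)) = conj (c (-n))) → (∀ n : (Fin r × Fin r × Fin r) → ℤ, c (fun w => n (Fin.rev w.1, Fin.rev w.2.1, w.2.2)) = c n) → ∀ (L M : ℕ) [NeZero L] [NeZero M], L₀ ≤ L → L ≤ M → Even L → Even M → let sh : (TorusSite 2 L × ZMod M) → (Fin r × Fin r × Fin r) → (TorusSite 2 L × ZMod M) := fun s w => (s.1 + ![((w.1 : ℕ) : ZMod L), ((w.2.1 : ℕ) : ZMod L)], s.2 + ((w.2.2 : ℕ) : ZMod M)); let F := fun (φ : (Fin r × Fin r × Fin r) → ℝ) => c.sum (fun n a => a * cexp (I * ((∑ w, (n w : ℝ) * φ w : ℝ) : ℂ))); let A : ((TorusSite 2 L × ZMod M) → ℝ) → ℂ := fun θ => (K : ℂ) * ∑ s, F (fun w => θ (sh s w)); let cube : Set ((TorusSite 2 L × ZMod M) → ℝ) := Set.pi Set.univ (fun _ => Set.Icc (0:ℝ) (2 * Real.pi)); let Z := ∫ θ in cube, cexp (-(A θ)); 0 < Z.re) →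
    (∀ (r : ℕ) (B c₀ : ℝ), 2 ≤ r → 0 < c₀ → ∃ K₀ : ℝ, ∃ L₀ : ℕ, ∃ C : ℝ, ∀ K : ℝ, K₀ ≤ K → ∀ c : ((Fin r × Fin r × Fin r) → ℤ) →₀ ℂ, (∀ n ∈ c.support, ∑ w, n w = 0) → c.sum (fun _ a => a) = 0 → c.sum (fun n a => ‖a‖ * Real.exp (∑ w, |(n w : ℝ)|)) ≤ B → (∀ φ : (Fin r × Fin r × Fin r) → ℝ, c₀ * ∑ w, ∑ w', (1 - Real.cos (φ w - φ w')) ≤ (c.sum (fun n a => a * cexp (I * ((∑ w, (n w : ℝ) * φ w : ℝ) : ℂ)))).re) → (∀ n : (Fin r × Fin r × Fin r) → ℤ, c (fun w => n (w.1, w.2.1, Fin.rev w.2.2)) = conj (c (-n))) → (∀ n : (Fin r × Fin r × Fin r) → ℤ, c (fun w => n (Fin.rev w.1, Fin.rev w.2.1, w.2.2)) = c n) → ∀ (L M : ℕ) [NeZero L] [NeZero M], L₀ ≤ L → L ≤ M → Even L → Even M → let sh : (TorusSite 2 L × ZMod M) → (Fin r × Fin r × Fin r) → (TorusSite 2 L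 × ZMod M) := fun s w => (s.1 + ![((w.1 : ℕ) : ZMod L), ((w.2.1 : ℕ) : ZMod L)], s.2 + ((w.2.2 : ℕ) : ZMod M)); let F := fun (φ : (Fin r × Fin r × Fin r) → ℝ) => c.sum (fun n a => a * cexp (I * ((∑ w, (n w : ℝ) * φ w : ℝ) : ℂ))); let A : ((TorusSite 2 L × ZMod M) → ℝ) → ℂ := fun θ => (K : ℂ) * ∑ s, F (fun w => θ (sh s w)); let cube : Set ((TorusSite 2 L × ZMod M) → ℝ) := Set.pi Set.univ (fun _ => Set.Icc (0:ℝ) (2 * Real.pi)); let Z := ∫ θ in cube, cexp (-(A θ)); (∫ θ in cube, (((∑ x : TorusSite 2 L, ∑ y : TorusSite 2 L, (1 - Real.cos (θ (x, 0) - θ (y, 0)))) / (L : ℝ) ^ 4 : ℝ) : ℂ) * cexp (-(A θ))).re ≤ C / (c₀ * K) * Z.re) →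
    ∀ (r : ℕ) (B c₀ : ℝ), 2 ≤ r → 0 < c₀ → ∃ K₀ : ℝ, ∃ L₀ : ℕ, ∀ K : ℝ, K₀ ≤ K → ∀ c : ((Fin r × Fin r × Fin r) → ℤ) →₀ ℂ, (∀ n ∈ c.support, ∑ w, n w = 0) → c.sum (fun _ a => a) = 0 → c.sum (fun n a => ‖a‖ * Real.exp (∑ w, |(n w : ℝ)|)) ≤ B → (∀ φ : (Fin r × Fin r × Fin r) → ℝ, c₀ * ∑ w, ∑ w', (1 - Real.cos (φ w - φ w')) ≤ (c.sum (fun n a => a * cexp (I * ((∑ w, (n w : ℝ) * φ w : ℝ) : ℂ)))).re) → (∀ n : (Fin r × Fin r × Fin r) → ℤ, c (fun w => n (w.1, w.2.1, Fin.rev w.2.2)) = conj (c (-n))) → (∀ n : (Fin r × Fin r × Fin r) → ℤ, c (fun w => n (Fin.rev w.1, Fin.rev w.2.1, w.2.2)) = c n) → ∀ (L M : ℕ) [NeZero L] [NeZero M], L₀ ≤ L → L ≤ M → Even L → Even M → let sh : (TorusSite 2 L × ZMod M) → (Fin r × Fin r × Fin r) → (TorusSite 2 L × ZMod M) := fun s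 w => (s.1 + ![((w.1 : ℕ) : ZMod L), ((w.2.1 : ℕ) : ZMod L)], s.2 + ((w.2.2 : ℕ) : ZMod M)); let F := fun (φ : (Fin r × Fin r × Fin r) → ℝ) => c.sum (fun n a => a * cexp (I * ((∑ w, (n w : ℝ) * φ w : ℝ) : ℂ))); let A : ((TorusSite 2 L × ZMod M) → ℝ) → ℂ := fun θ => (K : ℂ) * ∑ s, F (fun w => θ (sh s w)); let cube : Set ((TorusSite 2 L × ZMod M) → ℝ) := Set.pi Set.univ (fun _ => Set.Icc (0:ℝ) (2 * Real.pi)); let Z := ∫ θ in cube, cexp (-(A θ)); let O := fun (θ : (TorusSite 2 L × ZMod M) → ℝ) => ‖∑ x : TorusSite 2 L, cexp (I * (θ (x, 0) : ℂ))‖ ^ 2 / (L : ℝ) ^ 4; Z ≠ 0 ∧ (1/2 : ℝ) ≤ ((∫ θ in cube, (O θ : ℂ) * cexp (-(A θ))) / Z).re := by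
  intro h1 h2 r B c₀ hr hc₀
  -- positivity `0 < Re Z` for every `r ≥ 2` (thresholds `K₅, L₅`)
  have hpos : ∃ K₀ : ℝ, ∃ L₀ : ℕ, ∀ K : ℝ, K₀ ≤ K → ∀ c : ((Fin r × Fin r × Fin r) → ℤ) →₀ ℂ, (∀ n ∈ c.support, ∑ w, n w = 0) → c.sum (fun _ a => a) = 0 → c.sum (fun n a => ‖a‖ * Real.exp (∑ w, |(n w : ℝ)|)) ≤ B → (∀ φ : (Fin r × Fin r × Fin r) → ℝ, c₀ * ∑ w, ∑ w', (1 - Real.cos (φ w - φ w')) ≤ (c.sum (fun n a => a * cexp (I * ((∑ w, (n w : ℝ) * φ w : ℝ) : ℂ)))).re) → (∀ n : (Fin r × Fin r × Fin r) → ℤ, c (fun w => n (w.1, w.2.1, Fin.rev w.2.2)) = conj (c (-n))) → (∀ n : (Fin r × Fin r × Fin r) → ℤ, c (fun w => n (Fin.rev w.1, Fin.rev w.2.1, w.2.2)) = c n) → ∀ (L M : ℕ) [NeZero L] [NeZero M], L₀ ≤ L → L ≤ M → Even L → Even M → let sh : (TorusSite 2 L × ZMod M) → (Fin r × Fin r ×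 Fin r) → (TorusSite 2 L × ZMod M) := fun s w => (s.1 + ![((w.1 : ℕ) : ZMod L), ((w.2.1 : ℕ) : ZMod L)], s.2 + ((w.2.2 : ℕ) : ZMod M)); let F := fun (φ : (Fin r × Fin r × Fin r) → ℝ) => c.sum (fun n a => a * cexp (I * ((∑ w, (n w : ℝ) * φ w : ℝ) : ℂ))); let A : ((TorusSite 2 L × ZMod M) → ℝ) → ℂ := fun θ => (K : ℂ) * ∑ s, F (fun w => θ (sh s w)); let cube : Set ((TorusSite 2 L × ZMod M) → ℝ) := Set.pi Set.univ (fun _ => Set.Icc (0:ℝ) (2 * Real.pi)); let Z := ∫ θ in cube, cexp (-(A θ)); 0 < Z.re := by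
    rcases (show r = 2 ∨ 3 ≤ r by omega) with rfl | h3r
    · refine ⟨0, 0, ?_⟩
      intro K _ c _ _ _ _ hR _ L M _ _ _ _ _ hM
      have h := birEven_partitionFunction_pos c K L M (timeReflection_functional_of_table 2 c hR) hM
      exact h.1
    · exact h1 r B c₀ h3r hc₀
  obtain ⟨K₅, L₅, H5⟩ := hpos
  obtain ⟨K₆, L₆, C, H6⟩ := h2 r B c₀ hr hc₀
  refine ⟨max (max K₅ K₆) (max (2 * (C / c₀)) 1), max L₅ L₆, ?_⟩
  intro K hK c hU1 hN hA hC hR hP L M _ _ hL0 hLM hLe hMe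
  have hK5 : K₅ ≤ K := le_trans (le_trans (le_max_left _ _) (le_max_left _ _)) hK
  have hK6 : K₆ ≤ K := le_trans (le_trans (le_max_right _ _) (le_max_left _ _)) hK
  have hK1 : 1 ≤ K := le_trans (le_trans (le_max_right _ _) (le_max_right _ _)) hK
  have hK2 : 2 * (C / c₀) ≤ K := le_trans (le_trans (le_max_left _ _) (le_max_right _ _)) hK
  have hK0 : 0 ≤ K := by linarith
  have hL5 : L₅ ≤ L := le_trans (le_max_left _ _) hL0
  have hL6 : L₆ ≤ L := le_trans (le_max_right _ _) hL0
  have p5 := H5 K hK5 c hU1 hN hA hC hR hP L M hL5 hLM hLe hMe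
  have p6 := H6 K hK6 c hU1 hN hA hC hR hP L M hL6 hLM hLe hMe
  have hZreal := partitionFunction_conj_eq_self r c K L M (timeReflection_functional_of_table r c hR)
  dsimp only at p5 p6 hC hZreal ⊢
  have hZim := Complex.conj_eq_iff_im.mp hZreal
  -- `κ := C/(c₀K) ≤ 1/2`
  have hκ : C / (c₀ * K) ≤ 1 / 2 := by
    rcases le_or_gt C 0 with hC0 | hC0
    · have : C / (c₀ * K) ≤ 0 := div_nonpos_of_nonpos_of_nonneg hC0 (by positivity)
      linarith
    · have hcK : 0 < c₀ * K := by
        have : 0 < C / c₀ := div_pos hC0 hc₀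
        nlinarith
      rw [div_le_iff₀ hcK]
      have : C / c₀ * c₀ = C := div_mul_cancel₀ C hc₀.ne'
      nlinarith
  exact sg_core_avg L M _ (sg_continuous_weight K c _) (sg_norm_weight_le_one hK0 hc₀.le c hC _) hκ
    p5 hZim p6

/-- Alias of `stub_splitGlueR3` under its descriptive name: the sharpened split glue
`ComplexPositivityR3 → ComplexSliceDeficit → BirComplexStableXYR` (structural, Theses-free). [folklore] -/
theorem birComplexStableXYR_of_rePos3_of_sliceDeficit :
    (∀ (r : ℕ) (B c₀ : ℝ), 3 ≤ r → 0 < c₀ → ∃ K₀ : ℝ, ∃ L₀ : ℕ, ∀ K : ℝ, K₀ ≤ K → ∀ c : ((Fin r × Fin r × Fin r) → ℤ) →₀ ℂ, (∀ n ∈ c.support, ∑ w, n w = 0) → c.sum (fun _ a => a) = 0 → c.sum (fun n a => ‖a‖ * Real.exp (∑ w, |(n w : ℝ)|)) ≤ B → (∀ φ : (Fin r × Fin r × Fin r) → ℝ, c₀ * ∑ w, ∑ w', (1 - Real.cos (φ w - φ w')) ≤ (c.sum (fun n a => a * cexp (I * ((∑ w, (n w : ℝ) * φ w : ℝ) : ℂ)))).re)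 → (∀ n : (Fin r × Fin r × Fin r) → ℤ, c (fun w => n (w.1, w.2.1, Fin.rev w.2.2)) = conj (c (-n))) → (∀ n : (Fin r × Fin r × Fin r) → ℤ, c (fun w => n (Fin.rev w.1, Fin.rev w.2.1, w.2.2)) = c n) → ∀ (L M : ℕ) [NeZero L] [NeZero M], L₀ ≤ L → L ≤ M → Even L → Even M → let sh : (TorusSite 2 L × ZMod M) → (Fin r × Fin r × Fin r) → (TorusSite 2 L × ZMod M) := fun s w => (s.1 + ![((w.1 : ℕ) : ZMod L), ((w.2.1 : ℕ) : ZMod L)], s.2 + ((w.2.2 : ℕ) : ZMod M)); let F := fun (φ : (Fin r × Fin r × Fin r) → ℝ) => c.sum (fun n a => a * cexp (I * ((∑ w, (n w : ℝ) * φ w : ℝ) : ℂ))); let A : ((TorusSite 2 L × ZMod M) → ℝ) → ℂ := fun θ => (K : ℂ) * ∑ s, F (fun w => θ (sh s w)); let cube : Set ((TorusSite 2 L × ZMod M) → ℝ) := Set.pi Set.univ (fun _ => Set.Icc (0:ℝ) (2 * Real.pi)); let Z := ∫ θ in cube, cexp (-(A θ)); 0 < Z.re) →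
    (∀ (r : ℕ) (B c₀ : ℝ), 2 ≤ r → 0 < c₀ → ∃ K₀ : ℝ, ∃ L₀ : ℕ, ∃ C : ℝ, ∀ K : ℝ, K₀ ≤ K → ∀ c : ((Fin r × Fin r × Fin r) → ℤ) →₀ ℂ, (∀ n ∈ c.support, ∑ w, n w = 0) → c.sum (fun _ a => a) = 0 → c.sum (fun n a => ‖a‖ * Real.exp (∑ w, |(n w : ℝ)|)) ≤ B → (∀ φ : (Fin r × Fin r × Fin r) → ℝ, c₀ * ∑ w, ∑ w', (1 - Real.cos (φ w - φ w')) ≤ (c.sum (fun n a => a * cexp (I * ((∑ w, (n w : ℝ) * φ w : ℝ) : ℂ)))).re) → (∀ n : (Fin r × Fin r × Fin r) → ℤ, c (fun w => n (w.1, w.2.1, Fin.rev w.2.2)) = conj (c (-n))) → (∀ n : (Fin r × Fin r × Fin r) → ℤ, c (fun w => n (Fin.rev w.1, Fin.rev w.2.1, w.2.2)) = c n) → ∀ (L M : ℕ) [NeZero L] [NeZero M], L₀ ≤ L → L ≤ M → Even L → Even M → let sh : (TorusSite 2 L × ZMod M) → (Fin r × Fin r × Fin r) → (TorusSite 2 L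 × ZMod M) := fun s w => (s.1 + ![((w.1 : ℕ) : ZMod L), ((w.2.1 : ℕ) : ZMod L)], s.2 + ((w.2.2 : ℕ) : ZMod M)); let F := fun (φ : (Fin r × Fin r × Fin r) → ℝ) => c.sum (fun n a => a * cexp (I * ((∑ w, (n w : ℝ) * φ w : ℝ) : ℂ))); let A : ((TorusSite 2 L × ZMod M) → ℝ) → ℂ := fun θ => (K : ℂ) * ∑ s, F (fun w => θ (sh s w)); let cube : Set ((TorusSite 2 L × ZMod M) → ℝ) := Set.pi Set.univ (fun _ => Set.Icc (0:ℝ) (2 * Real.pi)); let Z := ∫ θ in cube, cexp (-(A θ)); (∫ θ in cube, (((∑ x : TorusSite 2 L, ∑ y : TorusSite 2 L, (1 - Real.cos (θ (x, 0) - θ (y, 0)))) / (L : ℝ) ^ 4 : ℝ) : ℂ) * cexp (-(A θ))).re ≤ C / (c₀ * K) * Z.re) →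
    ∀ (r : ℕ) (B c₀ : ℝ), 2 ≤ r → 0 < c₀ → ∃ K₀ : ℝ, ∃ L₀ : ℕ, ∀ K : ℝ, K₀ ≤ K → ∀ c : ((Fin r × Fin r × Fin r) → ℤ) →₀ ℂ, (∀ n ∈ c.support, ∑ w, n w = 0) → c.sum (fun _ a => a) = 0 → c.sum (fun n a => ‖a‖ * Real.exp (∑ w, |(n w : ℝ)|)) ≤ B → (∀ φ : (Fin r × Fin r × Fin r) → ℝ, c₀ * ∑ w, ∑ w', (1 - Real.cos (φ w - φ w')) ≤ (c.sum (fun n a => a * cexp (I * ((∑ w, (n w : ℝ) * φ w : ℝ) : ℂ)))).re) → (∀ n : (Fin r × Fin r × Fin r) → ℤ, c (fun w => n (w.1, w.2.1, Fin.rev w.2.2)) = conj (c (-n))) → (∀ n : (Fin r × Fin r × Fin r) → ℤ, c (fun w => n (Fin.rev w.1, Fin.rev w.2.1, w.2.2)) = c n) → ∀ (L M : ℕ) [NeZero L] [NeZero M], L₀ ≤ L → L ≤ M → Even L → Even M → let sh : (TorusSite 2 L × ZMod M) → (Fin r × Fin r × Fin r) → (TorusSite 2 L × ZMod M) := fun s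 w => (s.1 + ![((w.1 : ℕ) : ZMod L), ((w.2.1 : ℕ) : ZMod L)], s.2 + ((w.2.2 : ℕ) : ZMod M)); let F := fun (φ : (Fin r × Fin r × Fin r) → ℝ) => c.sum (fun n a => a * cexp (I * ((∑ w, (n w : ℝ) * φ w : ℝ) : ℂ))); let A : ((TorusSite 2 L × ZMod M) → ℝ) → ℂ := fun θ => (K : ℂ) * ∑ s, F (fun w => θ (sh s w)); let cube : Set ((TorusSite 2 L × ZMod M) → ℝ) := Set.pi Set.univ (fun _ => Set.Icc (0:ℝ) (2 * Real.pi)); let Z := ∫ θ in cube, cexp (-(A θ)); let O := fun (θ : (TorusSite 2 L × ZMod M) → ℝ) => ‖∑ x : TorusSite 2 L, cexp (I * (θ (x, 0) : ℂ))‖ ^ 2 / (L : ℝ) ^ 4; Z ≠ 0 ∧ (1/2 : ℝ) ≤ ((∫ θ in cube, (O θ : ℂ) * cexp (-(A θ))) / Z).re :=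
  stub_splitGlueR3

end SplitGlueR3

section SplitGlueHalf

/-- **The equivalent split's glue** (registered sub-goal `stub_splitGlueHalf` of skeleton S4′; alias
`birComplexStableXYR_of_rePos3_of_sliceOrderHalf` below): child 1 = `ComplexPositivityR3` (`0 < Re Z`, `r ≥ 3`), child 2 =
`ComplexSliceOrderHalf` — the slice-averaged deficit bound with the crux's OWN threshold, `Re ∫ D e^{−A} ≤ ½ Re Z` (`r ≥ 2`),
which given positivity is EQUIVALENT to conjunct 2 of the crux (`O = 1 − D`), so that `crux ⇔ child 1 ∧ child 2` (hidden
positivity for `⇒`).  Conclusion: the body of `BalabanIR.BirComplexStableXYR` (rev 11).  Thresholds `K₀ = max (max K₀¹ K₀²) 0`,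
`L₀ = max L₀¹ L₀²`. [folklore] -/
theorem stub_splitGlueHalf :
    (∀ (r : ℕ) (B c₀ : ℝ), 3 ≤ r → 0 < c₀ → ∃ K₀ : ℝ, ∃ L₀ : ℕ, ∀ K : ℝ, K₀ ≤ K → ∀ c : ((Fin r × Fin r × Fin r) → ℤ) →₀ ℂ, (∀ n ∈ c.support, ∑ w, n w = 0) → c.sum (fun _ a => a) = 0 → c.sum (fun n a => ‖a‖ * Real.exp (∑ w, |(n w : ℝ)|)) ≤ B → (∀ φ : (Fin r × Fin r × Fin r) → ℝ, c₀ * ∑ w, ∑ w', (1 - Real.cos (φ w - φ w')) ≤ (c.sum (fun n a => a * cexp (I * ((∑ w, (n w : ℝ) * φ w : ℝ) : ℂ)))).re) → (∀ n : (Fin r × Fin r × Fin r) → ℤ, c (fun w => n (w.1, w.2.1, Fin.rev w.2.2)) = conj (c (-n))) → (∀ n : (Fin r × Fin r × Fin r) → ℤ, c (fun w => n (Fin.rev w.1, Fin.rev w.2.1, w.2.2)) = c n) → ∀ (L M : ℕ) [NeZero L] [NeZero M], L₀ ≤ L → L ≤ M → Even L → Even M → let sh : (TorusSite 2 L × ZMod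 M) → (Fin r × Fin r × Fin r) → (TorusSite 2 L × ZMod M) := fun s w => (s.1 + ![((w.1 : ℕ) : ZMod L), ((w.2.1 : ℕ) : ZMod L)], s.2 + ((w.2.2 : ℕ) : ZMod M)); let F := fun (φ : (Fin r × Fin r × Fin r) → ℝ) => c.sum (fun n a => a * cexp (I * ((∑ w, (n w : ℝ) * φ w : ℝ) : ℂ))); let A : ((TorusSite 2 L × ZMod M) → ℝ) → ℂ := fun θ => (K : ℂ) * ∑ s, F (fun w => θ (sh s w)); let cube : Set ((TorusSite 2 L × ZMod M) → ℝ) := Set.pi Set.univ (fun _ => Set.Icc (0:ℝ) (2 * Real.pi)); let Z := ∫ θ in cube, cexp (-(A θ)); 0 < Z.re) →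
    (∀ (r : ℕ) (B c₀ : ℝ), 2 ≤ r → 0 < c₀ → ∃ K₀ : ℝ, ∃ L₀ : ℕ, ∀ K : ℝ, K₀ ≤ K → ∀ c : ((Fin r × Fin r × Fin r) → ℤ) →₀ ℂ, (∀ n ∈ c.support, ∑ w, n w = 0) → c.sum (fun _ a => a) = 0 → c.sum (fun n a => ‖a‖ * Real.exp (∑ w, |(n w : ℝ)|)) ≤ B → (∀ φ : (Fin r × Fin r × Fin r) → ℝ, c₀ * ∑ w, ∑ w', (1 - Real.cos (φ w - φ w')) ≤ (c.sum (fun n a => a * cexp (I * ((∑ w, (n w : ℝ) * φ w : ℝ) : ℂ)))).re) → (∀ n : (Fin r × Fin r × Fin r) → ℤ, c (fun w => n (w.1, w.2.1, Fin.rev w.2.2)) = conj (c (-n))) → (∀ n : (Fin r × Fin r × Fin r) → ℤ, c (fun w => n (Fin.rev w.1, Fin.rev w.2.1, w.2.2)) = c n) → ∀ (L M : ℕ) [NeZero L] [NeZero M], L₀ ≤ L → L ≤ M → Even L → Even M → let sh : (TorusSite 2 L × ZMod M) → (Fin r × Fin r × Fin r) → (TorusSite 2 L × ZMod M) := fun s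 w => (s.1 + ![((w.1 : ℕ) : ZMod L), ((w.2.1 : ℕ) : ZMod L)], s.2 + ((w.2.2 : ℕ) : ZMod M)); let F := fun (φ : (Fin r × Fin r × Fin r) → ℝ) => c.sum (fun n a => a * cexp (I * ((∑ w, (n w : ℝ) * φ w : ℝ) : ℂ))); let A : ((TorusSite 2 L × ZMod M) → ℝ) → ℂ := fun θ => (K : ℂ) * ∑ s, F (fun w => θ (sh s w)); let cube : Set ((TorusSite 2 L × ZMod M) → ℝ) := Set.pi Set.univ (fun _ => Set.Icc (0:ℝ) (2 * Real.pi)); let Z := ∫ θ in cube, cexp (-(A θ)); (∫ θ in cube, (((∑ x : TorusSite 2 L, ∑ y : TorusSite 2 L, (1 - Real.cos (θ (x, 0) - θ (y, 0)))) / (L : ℝ) ^ 4 : ℝ) : ℂ) * cexp (-(A θ))).re ≤ (1/2 : ℝ) * Z.re) →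
    ∀ (r : ℕ) (B c₀ : ℝ), 2 ≤ r → 0 < c₀ → ∃ K₀ : ℝ, ∃ L₀ : ℕ, ∀ K : ℝ, K₀ ≤ K → ∀ c : ((Fin r × Fin r × Fin r) → ℤ) →₀ ℂ, (∀ n ∈ c.support, ∑ w, n w = 0) → c.sum (fun _ a => a) = 0 → c.sum (fun n a => ‖a‖ * Real.exp (∑ w, |(n w : ℝ)|)) ≤ B → (∀ φ : (Fin r × Fin r × Fin r) → ℝ, c₀ * ∑ w, ∑ w', (1 - Real.cos (φ w - φ w')) ≤ (c.sum (fun n a => a * cexp (I * ((∑ w, (n w : ℝ) * φ w : ℝ) : ℂ)))).re) → (∀ n : (Fin r × Fin r × Fin r) → ℤ, c (fun w => n (w.1, w.2.1, Fin.rev w.2.2)) = conj (c (-n))) → (∀ n : (Fin r × Fin r × Fin r) → ℤ, c (fun w => n (Fin.rev w.1, Fin.rev w.2.1, w.2.2)) = c n) → ∀ (L M : ℕ) [NeZero L] [NeZero M], L₀ ≤ L → L ≤ M → Even L → Even M → let sh : (TorusSite 2 L × ZMod M) → (Fin r × Fin r × Fin r) → (TorusSite 2 L × ZMod M) := fun s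 w => (s.1 + ![((w.1 : ℕ) : ZMod L), ((w.2.1 : ℕ) : ZMod L)], s.2 + ((w.2.2 : ℕ) : ZMod M)); let F := fun (φ : (Fin r × Fin r × Fin r) → ℝ) => c.sum (fun n a => a * cexp (I * ((∑ w, (n w : ℝ) * φ w : ℝ) : ℂ))); let A : ((TorusSite 2 L × ZMod M) → ℝ) → ℂ := fun θ => (K : ℂ) * ∑ s, F (fun w => θ (sh s w)); let cube : Set ((TorusSite 2 L × ZMod M) → ℝ) := Set.pi Set.univ (fun _ => Set.Icc (0:ℝ) (2 * Real.pi)); let Z := ∫ θ in cube, cexp (-(A θ)); let O := fun (θ : (TorusSite 2 L × ZMod M) → ℝ) => ‖∑ x : TorusSite 2 L, cexp (I * (θ (x, 0) : ℂ))‖ ^ 2 / (L : ℝ) ^ 4; Z ≠ 0 ∧ (1/2 : ℝ) ≤ ((∫ θ in cube, (O θ : ℂ) * cexp (-(A θ))) / Z).re := by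
  intro h1 h2 r B c₀ hr hc₀
  -- positivity `0 < Re Z` for every `r ≥ 2` (thresholds `K₅, L₅`)
  have hpos : ∃ K₀ : ℝ, ∃ L₀ : ℕ, ∀ K : ℝ, K₀ ≤ K → ∀ c : ((Fin r × Fin r × Fin r) → ℤ) →₀ ℂ, (∀ n ∈ c.support, ∑ w, n w = 0) → c.sum (fun _ a => a) = 0 → c.sum (fun n a => ‖a‖ * Real.exp (∑ w, |(n w : ℝ)|)) ≤ B → (∀ φ : (Fin r × Fin r × Fin r) → ℝ, c₀ * ∑ w, ∑ w', (1 - Real.cos (φ w - φ w')) ≤ (c.sum (fun n a => a * cexp (I * ((∑ w, (n w : ℝ) * φ w : ℝ) : ℂ)))).re) → (∀ n : (Fin r × Fin r × Fin r) → ℤ, c (fun w => n (w.1, w.2.1, Fin.rev w.2.2)) = conj (c (-n))) → (∀ n : (Fin r × Fin r × Fin r) → ℤ, c (fun w => n (Fin.rev w.1, Fin.rev w.2.1, w.2.2)) = c n) → ∀ (L M : ℕ) [NeZero L] [NeZero M], L₀ ≤ L → L ≤ M → Even L → Even M → let sh : (TorusSite 2 L × ZMod M) → (Fin r × Fin r ×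 Fin r) → (TorusSite 2 L × ZMod M) := fun s w => (s.1 + ![((w.1 : ℕ) : ZMod L), ((w.2.1 : ℕ) : ZMod L)], s.2 + ((w.2.2 : ℕ) : ZMod M)); let F := fun (φ : (Fin r × Fin r × Fin r) → ℝ) => c.sum (fun n a => a * cexp (I * ((∑ w, (n w : ℝ) * φ w : ℝ) : ℂ))); let A : ((TorusSite 2 L × ZMod M) → ℝ) → ℂ := fun θ => (K : ℂ) * ∑ s, F (fun w => θ (sh s w)); let cube : Set ((TorusSite 2 L × ZMod M) → ℝ) := Set.pi Set.univ (fun _ => Set.Icc (0:ℝ) (2 * Real.pi)); let Z := ∫ θ in cube, cexp (-(A θ)); 0 < Z.re := by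
    rcases (show r = 2 ∨ 3 ≤ r by omega) with rfl | h3r
    · refine ⟨0, 0, ?_⟩
      intro K _ c _ _ _ _ hR _ L M _ _ _ _ _ hM
      have h := birEven_partitionFunction_pos c K L M (timeReflection_functional_of_table 2 c hR) hM
      exact h.1
    · exact h1 r B c₀ h3r hc₀
  obtain ⟨K₅, L₅, H5⟩ := hpos
  obtain ⟨K₆, L₆, H6⟩ := h2 r B c₀ hr hc₀
  refine ⟨max (max K₅ K₆) 0, max L₅ L₆, ?_⟩
  intro K hK c hU1 hN hA hC hR hP L M _ _ hL0 hLM hLe hMe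
  have hK5 : K₅ ≤ K := le_trans (le_trans (le_max_left _ _) (le_max_left _ _)) hK
  have hK6 : K₆ ≤ K := le_trans (le_trans (le_max_right _ _) (le_max_left _ _)) hK
  have hK0 : 0 ≤ K := le_trans (le_max_right _ _) hK
  have hL5 : L₅ ≤ L := le_trans (le_max_left _ _) hL0
  have hL6 : L₆ ≤ L := le_trans (le_max_right _ _) hL0
  have p5 := H5 K hK5 c hU1 hN hA hC hR hP L M hL5 hLM hLe hMe
  have p6 := H6 K hK6 c hU1 hN hA hC hR hP L M hL6 hLM hLe hMe
  have hZreal := partitionFunction_conj_eq_self r c K L M (timeReflection_functional_of_table r c hR)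
  dsimp only at p5 p6 hC hZreal ⊢
  have hZim := Complex.conj_eq_iff_im.mp hZreal
  exact sg_core_avg L M _ (sg_continuous_weight K c _) (sg_norm_weight_le_one hK0 hc₀.le c hC _) le_rfl
    p5 hZim p6

/-- Alias of `stub_splitGlueHalf`: the equivalent split's glue `ComplexPositivityR3 → ComplexSliceOrderHalf → crux`
(structural, Theses-free). [folklore] -/
theorem birComplexStableXYR_of_rePos3_of_sliceOrderHalf :
    (∀ (r : ℕ) (B c₀ : ℝ), 3 ≤ r → 0 < c₀ → ∃ K₀ : ℝ, ∃ L₀ : ℕ, ∀ K : ℝ, K₀ ≤ K → ∀ c : ((Fin r × Fin r × Fin r) → ℤ) →₀ ℂ, (∀ n ∈ c.support, ∑ w, n w = 0) → c.sum (fun _ a => a) = 0 → c.sum (fun n a => ‖a‖ * Real.exp (∑ w, |(n w : ℝ)|)) ≤ B → (∀ φ : (Fin r × Fin r × Fin r) → ℝ, c₀ * ∑ w, ∑ w', (1 - Real.cos (φ w - φ w')) ≤ (c.sum (fun n a => a * cexp (I * ((∑ w, (n w : ℝ) * φ w : ℝ) : ℂ)))).re) → (∀ n : (Fin r × Fin r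 × Fin r) → ℤ, c (fun w => n (w.1, w.2.1, Fin.rev w.2.2)) = conj (c (-n))) → (∀ n : (Fin r × Fin r × Fin r) → ℤ, c (fun w => n (Fin.rev w.1, Fin.rev w.2.1, w.2.2)) = c n) → ∀ (L M : ℕ) [NeZero L] [NeZero M], L₀ ≤ L → L ≤ M → Even L → Even M → let sh : (TorusSite 2 L × ZMod M) → (Fin r × Fin r × Fin r) → (TorusSite 2 L × ZMod M) := fun s w => (s.1 + ![((w.1 : ℕ) : ZMod L), ((w.2.1 : ℕ) : ZMod L)], s.2 + ((w.2.2 : ℕ) : ZMod M)); let F := fun (φ : (Fin r × Fin r × Fin r) → ℝ) => c.sum (fun n a => a * cexp (I * ((∑ w, (n w : ℝ) * φ w : ℝ) : ℂ))); let A : ((TorusSite 2 L × ZMod M) → ℝ) → ℂ := fun θ => (K : ℂ) * ∑ s, F (fun w => θ (sh s w)); let cube : Set ((TorusSite 2 L × ZMod M) → ℝ) := Set.pi Set.univ (fun _ => Set.Icc (0:ℝ) (2 * Real.pi)); let Z := ∫ θ in cube, cexp (-(A θ)); 0 < Z.re) →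
    (∀ (r : ℕ) (B c₀ : ℝ), 2 ≤ r → 0 < c₀ → ∃ K₀ : ℝ, ∃ L₀ : ℕ, ∀ K : ℝ, K₀ ≤ K → ∀ c : ((Fin r × Fin r × Fin r) → ℤ) →₀ ℂ, (∀ n ∈ c.support, ∑ w, n w = 0) → c.sum (fun _ a => a) = 0 → c.sum (fun n a => ‖a‖ * Real.exp (∑ w, |(n w : ℝ)|)) ≤ B → (∀ φ : (Fin r × Fin r × Fin r) → ℝ, c₀ * ∑ w, ∑ w', (1 - Real.cos (φ w - φ w')) ≤ (c.sum (fun n a => a * cexp (I * ((∑ w, (n w : ℝ) * φ w : ℝ) : ℂ)))).re) → (∀ n : (Fin r × Fin r × Fin r) → ℤ, c (fun w => n (w.1, w.2.1, Fin.rev w.2.2)) = conj (c (-n))) → (∀ n : (Fin r × Fin r × Fin r) → ℤ, c (fun w => n (Fin.rev w.1, Fin.rev w.2.1, w.2.2)) = c n) → ∀ (L M : ℕ) [NeZero L] [NeZero M], L₀ ≤ L → L ≤ M → Even L → Even M → let sh : (TorusSite 2 L × ZMod M) → (Fin r × Fin r × Fin r) → (TorusSite 2 L × ZMod M) := fun s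 w => (s.1 + ![((w.1 : ℕ) : ZMod L), ((w.2.1 : ℕ) : ZMod L)], s.2 + ((w.2.2 : ℕ) : ZMod M)); let F := fun (φ : (Fin r × Fin r × Fin r) → ℝ) => c.sum (fun n a => a * cexp (I * ((∑ w, (n w : ℝ) * φ w : ℝ) : ℂ))); let A : ((TorusSite 2 L × ZMod M) → ℝ) → ℂ := fun θ => (K : ℂ) * ∑ s, F (fun w => θ (sh s w)); let cube : Set ((TorusSite 2 L × ZMod M) → ℝ) := Set.pi Set.univ (fun _ => Set.Icc (0:ℝ) (2 * Real.pi)); let Z := ∫ θ in cube, cexp (-(A θ)); (∫ θ in cube, (((∑ x : TorusSite 2 L, ∑ y : TorusSite 2 L, (1 - Real.cos (θ (x, 0) - θ (y, 0)))) / (L : ℝ) ^ 4 : ℝ) : ℂ) * cexp (-(A θ))).re ≤ (1/2 : ℝ) * Z.re) →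
    ∀ (r : ℕ) (B c₀ : ℝ), 2 ≤ r → 0 < c₀ → ∃ K₀ : ℝ, ∃ L₀ : ℕ, ∀ K : ℝ, K₀ ≤ K → ∀ c : ((Fin r × Fin r × Fin r) → ℤ) →₀ ℂ, (∀ n ∈ c.support, ∑ w, n w = 0) → c.sum (fun _ a => a) = 0 → c.sum (fun n a => ‖a‖ * Real.exp (∑ w, |(n w : ℝ)|)) ≤ B → (∀ φ : (Fin r × Fin r × Fin r) → ℝ, c₀ * ∑ w, ∑ w', (1 - Real.cos (φ w - φ w')) ≤ (c.sum (fun n a => a * cexp (I * ((∑ w, (n w : ℝ) * φ w : ℝ) : ℂ)))).re) → (∀ n : (Fin r × Fin r × Fin r) → ℤ, c (fun w => n (w.1, w.2.1, Fin.rev w.2.2)) = conj (c (-n))) → (∀ n : (Fin r × Fin r × Fin r) → ℤ, c (fun w => n (Fin.rev w.1, Fin.rev w.2.1, w.2.2)) = c n) → ∀ (L M : ℕ) [NeZero L] [NeZero M], L₀ ≤ L → L ≤ M → Even L → Even M → let sh : (TorusSite 2 L × ZMod M) → (Fin r × Fin r × Fin r) → (TorusSite 2 L × ZMod M) := fun s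 w => (s.1 + ![((w.1 : ℕ) : ZMod L), ((w.2.1 : ℕ) : ZMod L)], s.2 + ((w.2.2 : ℕ) : ZMod M)); let F := fun (φ : (Fin r × Fin r × Fin r) → ℝ) => c.sum (fun n a => a * cexp (I * ((∑ w, (n w : ℝ) * φ w : ℝ) : ℂ))); let A : ((TorusSite 2 L × ZMod M) → ℝ) → ℂ := fun θ => (K : ℂ) * ∑ s, F (fun w => θ (sh s w)); let cube : Set ((TorusSite 2 L × ZMod M) → ℝ) := Set.pi Set.univ (fun _ => Set.Icc (0:ℝ) (2 * Real.pi)); let Z := ∫ θ in cube, cexp (-(A θ)); let O := fun (θ : (TorusSite 2 L × ZMod M) → ℝ) => ‖∑ x : TorusSite 2 L, cexp (I * (θ (x, 0) : ℂ))‖ ^ 2 / (L : ℝ) ^ 4; Z ≠ 0 ∧ (1/2 : ℝ) ≤ ((∫ θ in cube, (O θ : ℂ) * cexp (-(A θ))) / Z).re :=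
  stub_splitGlueHalf

end SplitGlueHalf

end Summit.HubbardSuperconductivity.HubbardSuperconductivity.Theorems

end
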